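import Summits.CriticalPhenomena.PercolationContinuityZ3.Theorems.Transplant.FKConnectivityAllQAntipodalMinorGluing
import Summits.CriticalPhenomena.PercolationContinuityZ3.Theorems.Transplant.FKConnectivityAllQAntipodalUpc
import HarnessLib

/-!
# Connectivity correlation inequalities for `φ_{w,q}`, every `q > 0` — file 75a: **THE LEVELWISE ANTIPODAL INEQUALITY (`C_∞⁺`) IS CLOSED
# UNDER ONE-SUMS, FOR ARBITRARY TEST FUNCTIONS ACROSS THE CUT VERTEX** (the odd / even decomposition)

Support file (`--supports stmt-CriticalPhenomena-4575`), FK sub-lane `prim-bschramm-fk-2` (gen 33); builds on p205010 (kernel theorem,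
internal audit signed; external expert review pending).  No definitions, no named facts, no sorries; standard axioms.

THE STATEMENT.  Let `E₁, E₂` be disjoint edge sets whose vertex supports meet in at most one vertex `m` (a one-sum, or a disjoint union),
`M_i, C_i ⊆ E_i` cells (`M_i` live, `C_i` contracted, disjoint).  Say that a cell `(M, C)` satisfies the LEVELWISE ANTIPODAL INEQUALITY if for
every `S ⊆ M`, every increasing `f` reading only `S`, every increasing `g` blind to `S` and every cut-off `J`,
`Σ_{γ ⊆ M : k(γ∪C)+k((M\γ)∪C) ≤ J} (f(γ∪C) − f((M\γ)∪C))·(g(γ∪C) − g((M\γ)∪C)) ≤ 0` (Conjecture `C_∞⁺` of the lane on this cell; a kernel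
theorem whenever `f` reads at most four edges of a 2-connected series–parallel host, files 64h/74h/74i).  **`FK.levels_le_oneSum_nonpos`: if
`(M₁, C₁)` and `(M₂, C₂)` satisfy it, so does `(M₁ ∪ M₂, C₁ ∪ C₂)`** — for ALL splits `S ⊆ M₁ ∪ M₂` and all `f, g`, however they couple the two
sides.  (File 36, `FK.apPsi_oneSum_nonpos_of`, gen 20, had the case `f` living on one side only, for the `q`-summed form.)

THE PROOF (odd / even decomposition across the cut vertex; memo FROM-fk-2-g33, FK-Q2 §42).  Write `γ = γ₁ ⊔ γ₂` and
`f̂(γ₁,γ₂) = f(γ∪C) − f((M\γ)∪C)`; the level is additive, `k + k̄ = (k₁+k̄₁) + (k₂+k̄₂) − 2|V|` (`FK.apExpC_series`).  For fixed `γ₂` split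
`f̂(·,γ₂) = P + E`, `P = ½(f̂(·,γ₂) + f̂(·,γ̄₂))` (odd under `γ₁ ↦ M₁\γ₁`), `E = ½(f̂(·,γ₂) − f̂(·,γ̄₂))` (even), and `ĝ = Q + D` likewise.  Then
`f̂ĝ = PQ + ED + (PD + EQ)`; the cross terms are odd in `γ₁` under a `γ₁ ↦ M₁\γ₁`-invariant level constraint, so they cancel
(`FK.sum_powerset_eq_zero_of_odd`); for each `γ₂`, `Σ_{γ₁} 1{level} PQ` is an instance of the hypothesis on `(M₁, C₁)` with the increasing test
functions `A ↦ ½(f((A∩M₁)∪γ₂∪C) + f((A∩M₁)∪γ̄₂∪C))` (reads only `S∩M₁`) and `B ↦ ½(g((B∩M₁)∪γ₂∪C) + g((B∩M₁)∪γ̄₂∪C))` (blind to `S∩M₁`); and for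
each `γ₁`, `Σ_{γ₂} 1{level} ED` is an instance of the hypothesis on `(M₂, C₂)` with `A ↦ ½(f(γ₁∪(A∩M₂)∪C) + f(γ̄₁∪(A∩M₂)∪C))` and the analogous
`g`-average — both again increasing, reading only / blind to `S ∩ M₂`.  No sign is lost anywhere: the identity is exact.
[cite: Grimmett2006, §1.4 eq. (1.20) (p. 15); §3.8 Thm. (3.90) (pp. 61–62); §3.9 (pp. 63–64)] [cite: Wagner2006, Thm. 5.8(d), §5.3]
-/

noncomputable section

namespace Summit.CriticalPhenomena.PercolationContinuityZ3.Theorems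

namespace FK

open SimpleGraph Literature.Probability.LatticeModels Literature.Probability.Percolation
open scoped Classical

variable {V : Type*} [Fintype V]

/-! ### Bookkeeping -/

omit [Fintype V] in
/-- A function odd under `γ ↦ E \ γ` sums to zero over the subsets of `E`. [folklore] -/
theorem sum_powerset_eq_zero_of_odd (E : Finset (Sym2 V)) {φ : Finset (Sym2 V) → ℝ}
    (hφ : ∀ γ : Finset (Sym2 V), γ ⊆ E → φ (E \ γ) = -φ γ) : ∑ γ ∈ E.powerset, φ γ = 0 := by
  have h := sum_powerset_flip E φ
  have h' : ∑ γ ∈ E.powerset, φ (E \ γ) = -∑ γ ∈ E.powerset, φ γ := by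
    rw [← Finset.sum_neg_distrib]
    exact Finset.sum_congr rfl fun γ hγ => hφ γ (Finset.mem_powerset.1 hγ)
  linarith

omit [Fintype V] in
/-- The antipodal exponent with a contracted set is symmetric under `γ ↦ M \ γ`. [folklore] -/
theorem apExpC_sdiff (M C : Finset (Sym2 V)) {γ : Finset (Sym2 V)} (hγ : γ ⊆ M) :
    apExpC M C (M \ γ) = apExpC M C γ := by
  unfold apExpC
  rw [Finset.sdiff_sdiff_eq_self hγ, add_comm]

omit [Fintype V] in
/-- Inserting a pair outside `M` does not change the trace on `M`. [folklore] -/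
theorem insert_inter_of_notMem' {M A : Finset (Sym2 V)} {e : Sym2 V} (he : e ∉ M) : insert e A ∩ M = A ∩ M := by
  ext x
  simp only [Finset.mem_inter, Finset.mem_insert]
  constructor
  · rintro ⟨h | h, hx⟩
    · exact absurd hx (h ▸ he)
    · exact ⟨h, hx⟩
  · rintro ⟨h, hx⟩
    exact ⟨Or.inr h, hx⟩

omit [Fintype V] in
/-- Inserting a pair of `M` commutes with the trace on `M`. [folklore] -/
theorem insert_inter_of_mem' {M A : Finset (Sym2 V)} {e : Sym2 V} (he : e ∈ M) : insert e A ∩ M = insert e (A ∩ M) := by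
  ext x
  simp only [Finset.mem_inter, Finset.mem_insert]
  constructor
  · rintro ⟨h | h, hx⟩
    · exact Or.inl h
    · exact Or.inr ⟨h, hx⟩
  · rintro (h | ⟨h, hx⟩)
    · exact ⟨Or.inl h, h ▸ he⟩
    · exact ⟨Or.inr h, hx⟩

omit [Fintype V] in
/-- **The averaged test function.**  For an increasing `f` and any `T, T', C`, the function
`A ↦ (f((A ∩ M) ∪ T ∪ C) + f((A ∩ M) ∪ T' ∪ C))/2` is increasing. [folklore] -/
theorem avg_mono {f : Finset (Sym2 V) → ℝ} (hfm : ∀ ⦃A B : Finset (Sym2 V)⦄, A ⊆ B → f A ≤ f B)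
    (M T T' C : Finset (Sym2 V)) ⦃A B : Finset (Sym2 V)⦄ (hAB : A ⊆ B) :
    (f (A ∩ M ∪ T ∪ C) + f (A ∩ M ∪ T' ∪ C)) / 2 ≤ (f (B ∩ M ∪ T ∪ C) + f (B ∩ M ∪ T' ∪ C)) / 2 := by
  have h1 : f (A ∩ M ∪ T ∪ C) ≤ f (B ∩ M ∪ T ∪ C) :=
    hfm (Finset.union_subset_union (Finset.union_subset_union (Finset.inter_subset_inter hAB le_rfl) le_rfl) le_rfl)
  have h2 : f (A ∩ M ∪ T' ∪ C) ≤ f (B ∩ M ∪ T' ∪ C) :=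
    hfm (Finset.union_subset_union (Finset.union_subset_union (Finset.inter_subset_inter hAB le_rfl) le_rfl) le_rfl)
  linarith

omit [Fintype V] in
/-- **The averaged test function does not read what `f` does not read inside `M`, nor anything outside `M`.** [folklore] -/
theorem avg_notRead {f : Finset (Sym2 V) → ℝ} {R : Finset (Sym2 V)}
    (hf : ∀ e : Sym2 V, e ∉ R → ∀ A : Finset (Sym2 V), f (insert e A) = f A) (M T T' C : Finset (Sym2 V)) :
    ∀ e : Sym2 V, e ∉ R ∩ M → ∀ A : Finset (Sym2 V),
      (f (insert e A ∩ M ∪ T ∪ C) + f (insert e A ∩ M ∪ T' ∪ C)) / 2 = (f (A ∩ M ∪ T ∪ C) + f (A ∩ M ∪ T' ∪ C)) / 2 := by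
  intro e he A
  by_cases heM : e ∈ M
  · have heR : e ∉ R := fun h => he (Finset.mem_inter.2 ⟨h, heM⟩)
    rw [insert_inter_of_mem' heM, Finset.insert_union, Finset.insert_union, hf e heR, Finset.insert_union, Finset.insert_union,
      hf e heR]
  · rw [insert_inter_of_notMem' heM]

omit [Fintype V] in
/-- **The averaged test function is blind to every pair of `M` to which `g` is blind.** [folklore] -/
theorem avg_blind {g : Finset (Sym2 V) → ℝ} {R : Finset (Sym2 V)}
    (hg : ∀ e ∈ R, ∀ A : Finset (Sym2 V), g (insert e A) = g A) (M T T' C : Finset (Sym2 V)) :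
    ∀ e ∈ R ∩ M, ∀ A : Finset (Sym2 V),
      (g (insert e A ∩ M ∪ T ∪ C) + g (insert e A ∩ M ∪ T' ∪ C)) / 2 = (g (A ∩ M ∪ T ∪ C) + g (A ∩ M ∪ T' ∪ C)) / 2 := by
  intro e he A
  have heR : e ∈ R := (Finset.mem_inter.1 he).1
  have heM : e ∈ M := (Finset.mem_inter.1 he).2
  rw [insert_inter_of_mem' heM, Finset.insert_union, Finset.insert_union, hg e heR, Finset.insert_union, Finset.insert_union,
    hg e heR]

omit [Fintype V] in
/-- The averaged test function, other-side-first form: increasing. [folklore] -/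
theorem avg_mono' {f : Finset (Sym2 V) → ℝ} (hfm : ∀ ⦃A B : Finset (Sym2 V)⦄, A ⊆ B → f A ≤ f B)
    (M T T' C : Finset (Sym2 V)) ⦃A B : Finset (Sym2 V)⦄ (hAB : A ⊆ B) :
    (f (T ∪ A ∩ M ∪ C) + f (T' ∪ A ∩ M ∪ C)) / 2 ≤ (f (T ∪ B ∩ M ∪ C) + f (T' ∪ B ∩ M ∪ C)) / 2 := by
  have h1 : f (T ∪ A ∩ M ∪ C) ≤ f (T ∪ B ∩ M ∪ C) :=
    hfm (Finset.union_subset_union (Finset.union_subset_union le_rfl (Finset.inter_subset_inter hAB le_rfl)) le_rfl)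
  have h2 : f (T' ∪ A ∩ M ∪ C) ≤ f (T' ∪ B ∩ M ∪ C) :=
    hfm (Finset.union_subset_union (Finset.union_subset_union le_rfl (Finset.inter_subset_inter hAB le_rfl)) le_rfl)
  linarith

omit [Fintype V] in
/-- The averaged test function, other-side-first form: reads only `R ∩ M`. [folklore] -/
theorem avg_notRead' {f : Finset (Sym2 V) → ℝ} {R : Finset (Sym2 V)}
    (hf : ∀ e : Sym2 V, e ∉ R → ∀ A : Finset (Sym2 V), f (insert e A) = f A) (M T T' C : Finset (Sym2 V)) :
    ∀ e : Sym2 V, e ∉ R ∩ M → ∀ A : Finset (Sym2 V),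
      (f (T ∪ insert e A ∩ M ∪ C) + f (T' ∪ insert e A ∩ M ∪ C)) / 2 = (f (T ∪ A ∩ M ∪ C) + f (T' ∪ A ∩ M ∪ C)) / 2 := by
  intro e he A
  by_cases heM : e ∈ M
  · have heR : e ∉ R := fun h => he (Finset.mem_inter.2 ⟨h, heM⟩)
    rw [insert_inter_of_mem' heM, Finset.union_insert, Finset.insert_union, hf e heR, Finset.union_insert, Finset.insert_union,
      hf e heR]
  · rw [insert_inter_of_notMem' heM]

omit [Fintype V] in
/-- The averaged test function, other-side-first form: blind to `R ∩ M`. [folklore] -/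
theorem avg_blind' {g : Finset (Sym2 V) → ℝ} {R : Finset (Sym2 V)}
    (hg : ∀ e ∈ R, ∀ A : Finset (Sym2 V), g (insert e A) = g A) (M T T' C : Finset (Sym2 V)) :
    ∀ e ∈ R ∩ M, ∀ A : Finset (Sym2 V),
      (g (T ∪ insert e A ∩ M ∪ C) + g (T' ∪ insert e A ∩ M ∪ C)) / 2 = (g (T ∪ A ∩ M ∪ C) + g (T' ∪ A ∩ M ∪ C)) / 2 := by
  intro e he A
  have heR : e ∈ R := (Finset.mem_inter.1 he).1
  have heM : e ∈ M := (Finset.mem_inter.1 he).2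
  rw [insert_inter_of_mem' heM, Finset.union_insert, Finset.insert_union, hg e heR, Finset.union_insert, Finset.insert_union,
    hg e heR]

/-! ### The one-sum closure theorem -/

section OneSum

variable {E₁ E₂ : Finset (Sym2 V)} {V₁ V₂ : Set V} {m : V}

/-- **`C_∞⁺` (the levelwise antipodal inequality) IS CLOSED UNDER ONE-SUMS — arbitrary test functions across the cut vertex.**
`E₁, E₂` disjoint edge sets whose vertex supports `V₁, V₂` meet in at most one vertex `m`; cells `M₁, C₁ ⊆ E₁` and `M₂, C₂ ⊆ E₂`
(live / contracted, disjoint).  HYPOTHESES `h₁`, `h₂`: on each cell, for every `S' ⊆ M_i`, every increasing `f'` reading only `S'`, every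
increasing `g'` blind to `S'` and every cut-off `J'`,
`Σ_{γ ⊆ M_i : k(γ∪C_i)+k((M_i\γ)∪C_i) ≤ J'} (f'(γ∪C_i) − f'((M_i\γ)∪C_i))·(g'(γ∪C_i) − g'((M_i\γ)∪C_i)) ≤ 0`.
CONCLUSION: the same inequality on the glued cell `(M₁ ∪ M₂, C₁ ∪ C₂)` for EVERY finite `S`, every increasing `f` reading only `S`, every
increasing `g` blind to `S`, every `J` — however `f` and `g` couple the two sides.  Proof: odd / even decomposition of `f̂(·, γ₂)` and
`ĝ(·, γ₂)` under `γ₁ ↦ M₁ \ γ₁`; the cross terms cancel, the pure terms are instances of `h₁` (for each `γ₂`) and of `h₂` (for each `γ₁`)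
with averaged test functions; the level is additive across the cut vertex (`FK.apExpC_series`).
[cite: Grimmett2006, §3.8 Thm. (3.90) (pp. 61–62); §3.9 (pp. 63–64)] [cite: Wagner2006, Thm. 5.8(d), §5.3] -/
theorem levels_le_oneSum_nonpos (hd : Disjoint E₁ E₂) (hV₁ : ∀ e ∈ (↑E₁ : Set (Sym2 V)), ∀ z ∈ e, z ∈ V₁)
    (hV₂ : ∀ e ∈ (↑E₂ : Set (Sym2 V)), ∀ z ∈ e, z ∈ V₂) (hS : V₁ ∩ V₂ ⊆ {m})
    {M₁ M₂ C₁ C₂ : Finset (Sym2 V)} (hM₁ : M₁ ⊆ E₁) (hM₂ : M₂ ⊆ E₂) (hC₁ : C₁ ⊆ E₁) (hC₂ : C₂ ⊆ E₂)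
    (hMC₁ : Disjoint M₁ C₁) (hMC₂ : Disjoint M₂ C₂)
    (h₁ : ∀ S' : Finset (Sym2 V), S' ⊆ M₁ → ∀ f' g' : Finset (Sym2 V) → ℝ,
      (∀ e : Sym2 V, e ∉ S' → ∀ A : Finset (Sym2 V), f' (insert e A) = f' A) →
      (∀ ⦃A B : Finset (Sym2 V)⦄, A ⊆ B → f' A ≤ f' B) →
      (∀ e ∈ S', ∀ A : Finset (Sym2 V), g' (insert e A) = g' A) →
      (∀ ⦃A B : Finset (Sym2 V)⦄, A ⊆ B → g' A ≤ g' B) → ∀ J' : ℕ,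
      ∑ γ ∈ M₁.powerset with apExpC M₁ C₁ γ ≤ J',
        (f' (γ ∪ C₁) - f' (M₁ \ γ ∪ C₁)) * (g' (γ ∪ C₁) - g' (M₁ \ γ ∪ C₁)) ≤ 0)
    (h₂ : ∀ S' : Finset (Sym2 V), S' ⊆ M₂ → ∀ f' g' : Finset (Sym2 V) → ℝ,
      (∀ e : Sym2 V, e ∉ S' → ∀ A : Finset (Sym2 V), f' (insert e A) = f' A) →
      (∀ ⦃A B : Finset (Sym2 V)⦄, A ⊆ B → f' A ≤ f' B) →
      (∀ e ∈ S', ∀ A : Finset (Sym2 V), g' (insert e A) = g' A) →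
      (∀ ⦃A B : Finset (Sym2 V)⦄, A ⊆ B → g' A ≤ g' B) → ∀ J' : ℕ,
      ∑ γ ∈ M₂.powerset with apExpC M₂ C₂ γ ≤ J',
        (f' (γ ∪ C₂) - f' (M₂ \ γ ∪ C₂)) * (g' (γ ∪ C₂) - g' (M₂ \ γ ∪ C₂)) ≤ 0)
    {S : Finset (Sym2 V)} {f g : Finset (Sym2 V) → ℝ}
    (hf : ∀ e : Sym2 V, e ∉ S → ∀ A : Finset (Sym2 V), f (insert e A) = f A)
    (hfm : ∀ ⦃A B : Finset (Sym2 V)⦄, A ⊆ B → f A ≤ f B)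
    (hg : ∀ e ∈ S, ∀ A : Finset (Sym2 V), g (insert e A) = g A)
    (hgm : ∀ ⦃A B : Finset (Sym2 V)⦄, A ⊆ B → g A ≤ g B) (J : ℕ) :
    ∑ γ ∈ (M₁ ∪ M₂).powerset with apExpC (M₁ ∪ M₂) (C₁ ∪ C₂) γ ≤ J,
      (f (γ ∪ (C₁ ∪ C₂)) - f ((M₁ ∪ M₂) \ γ ∪ (C₁ ∪ C₂))) * (g (γ ∪ (C₁ ∪ C₂)) - g ((M₁ ∪ M₂) \ γ ∪ (C₁ ∪ C₂))) ≤ 0 := by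
  have hdM : Disjoint M₁ M₂ := Finset.disjoint_of_subset_left hM₁ (Finset.disjoint_of_subset_right hM₂ hd)
  set C : Finset (Sym2 V) := C₁ ∪ C₂ with hCdef
  set N : ℕ := Fintype.card V with hNdef
  -- the two-sided antipodal differences
  set fh : Finset (Sym2 V) → Finset (Sym2 V) → ℝ := fun γ₁ γ₂ => f (γ₁ ∪ γ₂ ∪ C) - f (M₁ \ γ₁ ∪ M₂ \ γ₂ ∪ C) with hfh
  set gh : Finset (Sym2 V) → Finset (Sym2 V) → ℝ := fun γ₁ γ₂ => g (γ₁ ∪ γ₂ ∪ C) - g (M₁ \ γ₁ ∪ M₂ \ γ₂ ∪ C) with hgh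
  -- odd / even parts in `γ₁` (for fixed `γ₂`)
  set P : Finset (Sym2 V) → Finset (Sym2 V) → ℝ := fun γ₁ γ₂ => (fh γ₁ γ₂ + fh γ₁ (M₂ \ γ₂)) / 2 with hP
  set Ef : Finset (Sym2 V) → Finset (Sym2 V) → ℝ := fun γ₁ γ₂ => (fh γ₁ γ₂ - fh γ₁ (M₂ \ γ₂)) / 2 with hEf
  set Q : Finset (Sym2 V) → Finset (Sym2 V) → ℝ := fun γ₁ γ₂ => (gh γ₁ γ₂ + gh γ₁ (M₂ \ γ₂)) / 2 with hQ
  set Dg : Finset (Sym2 V) → Finset (Sym2 V) → ℝ := fun γ₁ γ₂ => (gh γ₁ γ₂ - gh γ₁ (M₂ \ γ₂)) / 2 with hDg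
  -- the indicator of the level constraint
  set ind : Finset (Sym2 V) → Finset (Sym2 V) → ℝ := fun γ₁ γ₂ =>
    if apExpC M₁ C₁ γ₁ + apExpC M₂ C₂ γ₂ ≤ J + 2 * N then 1 else 0 with hind
  -- Step 1: the glued sum as a double sum with the indicator
  have step1 : ∑ γ ∈ (M₁ ∪ M₂).powerset with apExpC (M₁ ∪ M₂) (C₁ ∪ C₂) γ ≤ J,
      (f (γ ∪ (C₁ ∪ C₂)) - f ((M₁ ∪ M₂) \ γ ∪ (C₁ ∪ C₂))) * (g (γ ∪ (C₁ ∪ C₂)) - g ((M₁ ∪ M₂) \ γ ∪ (C₁ ∪ C₂))) =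
      ∑ γ₁ ∈ M₁.powerset, ∑ γ₂ ∈ M₂.powerset, ind γ₁ γ₂ * (fh γ₁ γ₂ * gh γ₁ γ₂) := by
    rw [Finset.sum_filter, sum_powerset_union_disj hdM]
    refine Finset.sum_congr rfl fun γ₁ hγ₁ => Finset.sum_congr rfl fun γ₂ hγ₂ => ?_
    have hγ₁' : γ₁ ⊆ M₁ := Finset.mem_powerset.1 hγ₁
    have hγ₂' : γ₂ ⊆ M₂ := Finset.mem_powerset.1 hγ₂
    have hlev := apExpC_series hd hV₁ hV₂ hS hM₁ hM₂ hC₁ hC₂ hγ₁' hγ₂'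
    have hiff : apExpC (M₁ ∪ M₂) (C₁ ∪ C₂) (γ₁ ∪ γ₂) ≤ J ↔ apExpC M₁ C₁ γ₁ + apExpC M₂ C₂ γ₂ ≤ J + 2 * N := by
      rw [← hlev, hNdef]; omega
    have hsd : (M₁ ∪ M₂) \ (γ₁ ∪ γ₂) ∪ (C₁ ∪ C₂) = M₁ \ γ₁ ∪ M₂ \ γ₂ ∪ C := by rw [union_sdiff_union hdM hγ₁' hγ₂']
    simp only [hind, hfh, hgh]
    by_cases hle : apExpC (M₁ ∪ M₂) (C₁ ∪ C₂) (γ₁ ∪ γ₂) ≤ J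
    · rw [if_pos hle, if_pos (hiff.1 hle), one_mul, hsd]
    · rw [if_neg hle, if_neg (fun h => hle (hiff.2 h)), zero_mul]
  rw [step1]
  -- Step 2: the pointwise odd / even expansion
  have step2 : ∀ γ₁ γ₂ : Finset (Sym2 V), ind γ₁ γ₂ * (fh γ₁ γ₂ * gh γ₁ γ₂) =
      ind γ₁ γ₂ * (P γ₁ γ₂ * Q γ₁ γ₂) + ind γ₁ γ₂ * (Ef γ₁ γ₂ * Dg γ₁ γ₂) +
        ind γ₁ γ₂ * (P γ₁ γ₂ * Dg γ₁ γ₂ + Ef γ₁ γ₂ * Q γ₁ γ₂) := by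
    intro γ₁ γ₂; simp only [hP, hEf, hQ, hDg]; ring
  simp_rw [step2, Finset.sum_add_distrib]
  -- symmetries under `γ₁ ↦ M₁ \ γ₁`
  have fh_flip : ∀ γ₁ γ₂ : Finset (Sym2 V), γ₁ ⊆ M₁ → γ₂ ⊆ M₂ → fh (M₁ \ γ₁) γ₂ = -fh γ₁ (M₂ \ γ₂) := by
    intro γ₁ γ₂ hγ₁ hγ₂
    simp only [hfh, Finset.sdiff_sdiff_eq_self hγ₁, Finset.sdiff_sdiff_eq_self hγ₂]
    ring
  have gh_flip : ∀ γ₁ γ₂ : Finset (Sym2 V), γ₁ ⊆ M₁ → γ₂ ⊆ M₂ → gh (M₁ \ γ₁) γ₂ = -gh γ₁ (M₂ \ γ₂) := by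
    intro γ₁ γ₂ hγ₁ hγ₂
    simp only [hgh, Finset.sdiff_sdiff_eq_self hγ₁, Finset.sdiff_sdiff_eq_self hγ₂]
    ring
  have P_flip : ∀ γ₁ γ₂ : Finset (Sym2 V), γ₁ ⊆ M₁ → γ₂ ⊆ M₂ → P (M₁ \ γ₁) γ₂ = -P γ₁ γ₂ := by
    intro γ₁ γ₂ hγ₁ hγ₂
    simp only [hP]
    rw [fh_flip γ₁ γ₂ hγ₁ hγ₂, fh_flip γ₁ (M₂ \ γ₂) hγ₁ Finset.sdiff_subset, Finset.sdiff_sdiff_eq_self hγ₂]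
    ring
  have Ef_flip : ∀ γ₁ γ₂ : Finset (Sym2 V), γ₁ ⊆ M₁ → γ₂ ⊆ M₂ → Ef (M₁ \ γ₁) γ₂ = Ef γ₁ γ₂ := by
    intro γ₁ γ₂ hγ₁ hγ₂
    simp only [hEf]
    rw [fh_flip γ₁ γ₂ hγ₁ hγ₂, fh_flip γ₁ (M₂ \ γ₂) hγ₁ Finset.sdiff_subset, Finset.sdiff_sdiff_eq_self hγ₂]
    ring
  have Q_flip : ∀ γ₁ γ₂ : Finset (Sym2 V), γ₁ ⊆ M₁ → γ₂ ⊆ M₂ → Q (M₁ \ γ₁) γ₂ = -Q γ₁ γ₂ := by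
    intro γ₁ γ₂ hγ₁ hγ₂
    simp only [hQ]
    rw [gh_flip γ₁ γ₂ hγ₁ hγ₂, gh_flip γ₁ (M₂ \ γ₂) hγ₁ Finset.sdiff_subset, Finset.sdiff_sdiff_eq_self hγ₂]
    ring
  have Dg_flip : ∀ γ₁ γ₂ : Finset (Sym2 V), γ₁ ⊆ M₁ → γ₂ ⊆ M₂ → Dg (M₁ \ γ₁) γ₂ = Dg γ₁ γ₂ := by
    intro γ₁ γ₂ hγ₁ hγ₂
    simp only [hDg]
    rw [gh_flip γ₁ γ₂ hγ₁ hγ₂, gh_flip γ₁ (M₂ \ γ₂) hγ₁ Finset.sdiff_subset, Finset.sdiff_sdiff_eq_self hγ₂]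
    ring
  have ind_flip : ∀ γ₁ γ₂ : Finset (Sym2 V), γ₁ ⊆ M₁ → ind (M₁ \ γ₁) γ₂ = ind γ₁ γ₂ := by
    intro γ₁ γ₂ hγ₁
    simp only [hind, apExpC_sdiff M₁ C₁ hγ₁]
  -- Step 3: the cross terms cancel
  have step3 : ∑ γ₁ ∈ M₁.powerset, ∑ γ₂ ∈ M₂.powerset, ind γ₁ γ₂ * (P γ₁ γ₂ * Dg γ₁ γ₂ + Ef γ₁ γ₂ * Q γ₁ γ₂) = 0 := by
    rw [Finset.sum_comm]
    refine Finset.sum_eq_zero fun γ₂ hγ₂ => ?_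
    have hγ₂' : γ₂ ⊆ M₂ := Finset.mem_powerset.1 hγ₂
    refine sum_powerset_eq_zero_of_odd M₁ fun γ₁ hγ₁ => ?_
    rw [ind_flip γ₁ γ₂ hγ₁, P_flip γ₁ γ₂ hγ₁ hγ₂', Ef_flip γ₁ γ₂ hγ₁ hγ₂', Q_flip γ₁ γ₂ hγ₁ hγ₂', Dg_flip γ₁ γ₂ hγ₁ hγ₂']
    ring
  rw [step3, add_zero]
  -- Step 4: the `PQ` terms — for each `γ₂` an instance of `h₁` with averaged test functions
  have step4 : ∑ γ₁ ∈ M₁.powerset, ∑ γ₂ ∈ M₂.powerset, ind γ₁ γ₂ * (P γ₁ γ₂ * Q γ₁ γ₂) ≤ 0 := by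
    rw [Finset.sum_comm]
    refine Finset.sum_nonpos fun γ₂ hγ₂ => ?_
    have hγ₂' : γ₂ ⊆ M₂ := Finset.mem_powerset.1 hγ₂
    -- the averaged test functions on side 1
    set f₁ : Finset (Sym2 V) → ℝ := fun A => (f (A ∩ M₁ ∪ γ₂ ∪ C) + f (A ∩ M₁ ∪ (M₂ \ γ₂) ∪ C)) / 2 with hf₁
    set g₁ : Finset (Sym2 V) → ℝ := fun A => (g (A ∩ M₁ ∪ γ₂ ∪ C) + g (A ∩ M₁ ∪ (M₂ \ γ₂) ∪ C)) / 2 with hg₁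
    have hPf : ∀ γ₁ : Finset (Sym2 V), γ₁ ⊆ M₁ → P γ₁ γ₂ = f₁ (γ₁ ∪ C₁) - f₁ (M₁ \ γ₁ ∪ C₁) := by
      intro γ₁ hγ₁
      have e1 : (γ₁ ∪ C₁) ∩ M₁ = γ₁ := by
        rw [Finset.union_inter_distrib_right, Finset.inter_eq_left.2 hγ₁, Finset.disjoint_iff_inter_eq_empty.1 hMC₁.symm,
          Finset.union_empty]
      have e2 : (M₁ \ γ₁ ∪ C₁) ∩ M₁ = M₁ \ γ₁ := by
        rw [Finset.union_inter_distrib_right, Finset.inter_eq_left.2 Finset.sdiff_subset,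
          Finset.disjoint_iff_inter_eq_empty.1 hMC₁.symm, Finset.union_empty]
      simp only [hP, hfh, hf₁, e1, e2, Finset.sdiff_sdiff_eq_self hγ₂']
      ring
    have hQg : ∀ γ₁ : Finset (Sym2 V), γ₁ ⊆ M₁ → Q γ₁ γ₂ = g₁ (γ₁ ∪ C₁) - g₁ (M₁ \ γ₁ ∪ C₁) := by
      intro γ₁ hγ₁
      have e1 : (γ₁ ∪ C₁) ∩ M₁ = γ₁ := by
        rw [Finset.union_inter_distrib_right, Finset.inter_eq_left.2 hγ₁, Finset.disjoint_iff_inter_eq_empty.1 hMC₁.symm,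
          Finset.union_empty]
      have e2 : (M₁ \ γ₁ ∪ C₁) ∩ M₁ = M₁ \ γ₁ := by
        rw [Finset.union_inter_distrib_right, Finset.inter_eq_left.2 Finset.sdiff_subset,
          Finset.disjoint_iff_inter_eq_empty.1 hMC₁.symm, Finset.union_empty]
      simp only [hQ, hgh, hg₁, e1, e2, Finset.sdiff_sdiff_eq_self hγ₂']
      ring
    -- the instance of `h₁`
    by_cases hJ : apExpC M₂ C₂ γ₂ ≤ J + 2 * N
    · have key := h₁ (S ∩ M₁) Finset.inter_subset_right f₁ g₁ (avg_notRead hf M₁ γ₂ (M₂ \ γ₂) C)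
        (fun A B hAB => avg_mono hfm M₁ γ₂ (M₂ \ γ₂) C hAB) (avg_blind hg M₁ γ₂ (M₂ \ γ₂) C)
        (fun A B hAB => avg_mono hgm M₁ γ₂ (M₂ \ γ₂) C hAB) (J + 2 * N - apExpC M₂ C₂ γ₂)
      rw [Finset.sum_filter] at key
      refine le_of_eq_of_le (Finset.sum_congr rfl fun γ₁ hγ₁ => ?_) key
      have hγ₁' : γ₁ ⊆ M₁ := Finset.mem_powerset.1 hγ₁
      simp only [hind]
      by_cases hle : apExpC M₁ C₁ γ₁ + apExpC M₂ C₂ γ₂ ≤ J + 2 * N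
      · have hle' : apExpC M₁ C₁ γ₁ ≤ J + 2 * N - apExpC M₂ C₂ γ₂ := by omega
        rw [if_pos hle, if_pos hle', one_mul, hPf γ₁ hγ₁', hQg γ₁ hγ₁']
      · have hle' : ¬ apExpC M₁ C₁ γ₁ ≤ J + 2 * N - apExpC M₂ C₂ γ₂ := by omega
        rw [if_neg hle, if_neg hle', zero_mul]
    · refine le_of_eq (Finset.sum_eq_zero fun γ₁ _ => ?_)
      simp only [hind]
      rw [if_neg (by omega), zero_mul]
  -- Step 5: the `ED` terms — for each `γ₁` an instance of `h₂` with averaged test functions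
  have step5 : ∑ γ₁ ∈ M₁.powerset, ∑ γ₂ ∈ M₂.powerset, ind γ₁ γ₂ * (Ef γ₁ γ₂ * Dg γ₁ γ₂) ≤ 0 := by
    refine Finset.sum_nonpos fun γ₁ hγ₁ => ?_
    have hγ₁' : γ₁ ⊆ M₁ := Finset.mem_powerset.1 hγ₁
    set f₂ : Finset (Sym2 V) → ℝ := fun A => (f (γ₁ ∪ A ∩ M₂ ∪ C) + f (M₁ \ γ₁ ∪ A ∩ M₂ ∪ C)) / 2 with hf₂
    set g₂ : Finset (Sym2 V) → ℝ := fun A => (g (γ₁ ∪ A ∩ M₂ ∪ C) + g (M₁ \ γ₁ ∪ A ∩ M₂ ∪ C)) / 2 with hg₂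
    have e1 : ∀ γ₂ : Finset (Sym2 V), γ₂ ⊆ M₂ → (γ₂ ∪ C₂) ∩ M₂ = γ₂ := fun γ₂ hγ₂ => by
      rw [Finset.union_inter_distrib_right, Finset.inter_eq_left.2 hγ₂, Finset.disjoint_iff_inter_eq_empty.1 hMC₂.symm,
        Finset.union_empty]
    have e2 : ∀ γ₂ : Finset (Sym2 V), (M₂ \ γ₂ ∪ C₂) ∩ M₂ = M₂ \ γ₂ := fun γ₂ => by
      rw [Finset.union_inter_distrib_right, Finset.inter_eq_left.2 Finset.sdiff_subset,
        Finset.disjoint_iff_inter_eq_empty.1 hMC₂.symm, Finset.union_empty]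
    have hEf₂ : ∀ γ₂ : Finset (Sym2 V), γ₂ ⊆ M₂ → Ef γ₁ γ₂ = f₂ (γ₂ ∪ C₂) - f₂ (M₂ \ γ₂ ∪ C₂) := by
      intro γ₂ hγ₂
      simp only [hEf, hfh, hf₂, e1 γ₂ hγ₂, e2 γ₂, Finset.sdiff_sdiff_eq_self hγ₂]
      ring
    have hDg₂ : ∀ γ₂ : Finset (Sym2 V), γ₂ ⊆ M₂ → Dg γ₁ γ₂ = g₂ (γ₂ ∪ C₂) - g₂ (M₂ \ γ₂ ∪ C₂) := by
      intro γ₂ hγ₂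
      simp only [hDg, hgh, hg₂, e1 γ₂ hγ₂, e2 γ₂, Finset.sdiff_sdiff_eq_self hγ₂]
      ring
    by_cases hJ : apExpC M₁ C₁ γ₁ ≤ J + 2 * N
    · have key := h₂ (S ∩ M₂) Finset.inter_subset_right f₂ g₂ (avg_notRead' hf M₂ γ₁ (M₁ \ γ₁) C)
        (fun A B hAB => avg_mono' hfm M₂ γ₁ (M₁ \ γ₁) C hAB) (avg_blind' hg M₂ γ₁ (M₁ \ γ₁) C)
        (fun A B hAB => avg_mono' hgm M₂ γ₁ (M₁ \ γ₁) C hAB) (J + 2 * N - apExpC M₁ C₁ γ₁)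
      rw [Finset.sum_filter] at key
      refine le_of_eq_of_le (Finset.sum_congr rfl fun γ₂ hγ₂ => ?_) key
      have hγ₂' : γ₂ ⊆ M₂ := Finset.mem_powerset.1 hγ₂
      simp only [hind]
      by_cases hle : apExpC M₁ C₁ γ₁ + apExpC M₂ C₂ γ₂ ≤ J + 2 * N
      · have hle' : apExpC M₂ C₂ γ₂ ≤ J + 2 * N - apExpC M₁ C₁ γ₁ := by omega
        rw [if_pos hle, if_pos hle', one_mul, hEf₂ γ₂ hγ₂', hDg₂ γ₂ hγ₂']
      · have hle' : ¬ apExpC M₂ C₂ γ₂ ≤ J + 2 * N - apExpC M₁ C₁ γ₁ := by omega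
        rw [if_neg hle, if_neg hle', zero_mul]
    · refine le_of_eq (Finset.sum_eq_zero fun γ₂ _ => ?_)
      simp only [hind]
      rw [if_neg (by omega), zero_mul]
  linarith [step4, step5]

end OneSum

end FK

end Summit.CriticalPhenomena.PercolationContinuityZ3.Theorems

end
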